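import Summits.Ventures.YMGap.BEDoor.FormatInputs

/-!
# BEDoor / StripFormat — §5c the door END TO END from format data, §6 MEASURE GLUE to the member's own torus measure
# (module 07/11 of the Bakry–Émery door, LIFT edition v8.3 = parts `StripFormat` (v8.2 module 11); cell `ym-beyond`, seat P4)

HONEST FRAMING (cell `ym-beyond`, seat P4 «Hessian-currency receiver», lens Y2; HUMAN RULINGS D-0035 / D-0037; memo `HOME/ROUTE-P4Y2.md` v8.1 +
g10 addendum, spec `HOME/ROUTE-P4Y2-LIFT-SPEC-v83.md`; LIFT edition v8.3 = the v8.2 module bodies of `HOME/ROUTE-P4Y2-Sketch.lean` v8.1, byte-identical and in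
order, re-packed into 11 ≤ 400-line modules (fewer olean round-trips; director-ym line №2 (B)); the g10 appendix `OpenStrip` is a separate, UNQUEUED HOME file (line №3 (D))).  FINITE-LATTICE
statements at STRONG effective coupling: a RECEIVER («door») in HESSIAN (Bakry–Émery) currency for renormalisation-group output, typed over the
tree's generic clustering chain `Thresholds/SharpClustering*` + `Thresholds/LatticeBakryEmery*`, complementary to the Dobrushin-currency door
`YM4Door/*` (LITERALLY the same INPUT predicate `QuasiLocalGaugePerturbation.HasAnalyticNormLE … stripDomain`, the same OUTPUT predicate
`RobustBall.ClustersWith`; no residual hypothesis: Osgood regularity is the tree's `Literature.Analysis.Complex.SCV.contDiffOn_infty`,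
part `Osgood` of module `AnalyticStrip`).  Nothing here is a statement about `β → ∞`, the continuum limit or the Clay problem; NO effective action is asserted to be at
the door (that INPUT is not in print for `d = 4`); the verdict «the two windows do not meet» is unchanged in this currency.
WHAT THIS IS NOT (ladder rung R2d; director-ym line №2 (B)): every door of this LIFT is an entry on the STRONG-COUPLING BANK of THE NUMBER —
finite-lattice exponential clustering at SMALL `|β|` and small strip norm `η` of the perturbation (`SU(2)`, `d = 4`: `16.2|β| + 4.4η < 1`, module `SU2`,
conclusion literally `RobustBall.ClustersWith`) — NOT clustering at weak coupling, NOT a statement at large `β`, NOT the mass gap.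
No conjecture name, no `sorry`, no axiom beyond the standard three; every theorem is bookkeeping over the tree. [folklore]
References: H. Shen, R. Zhu, X. Zhu, CMP 400 (2023) 805 (arXiv:2204.12737) Thm 1.2, Cor. 4.4/4.11; D. Bakry, M. Émery, LNM 1123 (1985);
T. Bałaban, CMP 109 (1987) 249, (1.18)–(1.22) (analyticity format); L. Hörmander, An Introduction to Complex Analysis in Several Variables
(1973) Thm 2.2.1/2.2.6 (Osgood); E. J. McShane, Bull. AMS 40 (1934) 837 (Lipschitz extension).

THIS MODULE, part `StripFormat` (§5c the door END TO END from format data, §6 MEASURE GLUE to the member's own torus measure): `stripProfile`,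
`beDoorQL_gibbsCov_le_of_strip`, ★★ `beDoorQL_gibbsCov_le_of_format` (format data `(X_i, M_i, r, δ_i)` of a finite sum of smooth activities + door ⇒
clustering of `gibbsCov (wilsonPot β + Σ E_i)`, NO `|X|` factor in the Hessian load); ★★ `covariance_perturbedMeasure_eq` (for `W :
QuasiLocalGaugePerturbation d L SU(N) b` with `R ∘ emb = −W.total`, covariances in `W.perturbedMeasure fundamentalRep (Nβ)` ARE `gibbsCov (wilsonPot β
+ R)`), `perturbedMeasure_cov_le_of_format`, `perturbedMeasure_cov_le_of_poly`.
-/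

noncomputable section

open scoped Matrix ComplexConjugate BigOperators Matrix.Norms.Frobenius ContDiff Topology
open Matrix Complex Finset MeasureTheory Filter
open Literature.MathematicalPhysics.QuantumFieldTheory
open Literature.MathematicalPhysics.QuantumFieldTheory.SUNBakryEmery (SUN FrameIdx frame)

namespace Summit.Ventures.YMGap.BEDoor

open Summit.Ventures.YMGap Summit.Ventures.YMGap.LatticeBakryEmery Summit.Ventures.YMGap.SharpClustering
open Summit.Ventures.YMGap.HessianSharp

universe u

/-! ## §5c END TO END ON THE TORUS (PROVED): strip-format effective action ⇒ volume-uniform exponential clustering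
One theorem from Bałaban's OUTPUT FORMAT to the IR conclusion: the Wilson action at effective coupling `β` plus a finite sum of
local terms `E i` (smooth, analytic in the strip format `StripBoundOn (E i) (X i) (M i) r`, jointly C²-approximable by
polynomials) has exponentially clustering Gibbs covariances, uniformly in the volume `L`, as soon as the quasi-local door
`N/2 − (N|β|Λ₀ + η) − (max(6(d−1)N|β|,0)(e^κ−1) + Θ) > 0` is open, where `η = sup_e Σ_{i : e ∈ X i} 2M_i/r²` is the per-link
LOAD and `Θ` bounds the weighted row sums of the strip profile `Σ_i 1_{e,e'∈X_i} 4M_i/r²`. -/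

section StripDoor

variable {ι : Type u} [Fintype ι] [DecidableEq ι] {N : ℕ}

/-- The off-diagonal profile generated by a family of strip data: `h e e' = Σ_{i : e,e' ∈ X i} 4M_i/r²`. [folklore] -/
def stripProfile {K : Type*} (s : Finset K) (X : K → Finset ι) (M : K → ℝ) (r : ℝ) (e e' : ι) : ℝ :=
  ∑ i ∈ s, if e ∈ X i ∧ e' ∈ X i then 4 * M i / r ^ 2 else 0

omit [Fintype ι] in
/-- The strip off-diagonal profile is entrywise non-negative when the bounds `M i` are. [folklore] -/
theorem stripProfile_nonneg {K : Type*} {s : Finset K} {X : K → Finset ι} {M : K → ℝ} {r : ℝ}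
    (hM : ∀ i ∈ s, 0 ≤ M i) (e e' : ι) : 0 ≤ stripProfile s X M r e e' :=
  Finset.sum_nonneg fun i hi => by
    split_ifs
    · exact div_nonneg (mul_nonneg (by norm_num) (hM i hi)) (sq_nonneg r)
    · exact le_rfl

omit [Fintype ι] in
/-- The strip off-diagonal profile is symmetric. [folklore] -/
theorem stripProfile_symm {K : Type*} (s : Finset K) (X : K → Finset ι) (M : K → ℝ) (r : ℝ) (e e' : ι) :
    stripProfile s X M r e e' = stripProfile s X M r e' e :=
  Finset.sum_congr rfl fun i _ => by simp only [and_comm]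

/-- Off-diagonal profile of a sum of strip-format local terms. [folklore] -/
theorem offDiagHessBound_sum_of_strip {K : Type*} (s : Finset K) {E : K → Cfg ι N → ℝ}
    (hE : ∀ i, ContDiff ℝ ∞ (E i)) {X : K → Finset ι} {M : K → ℝ} {r : ℝ} (hr : 0 < r) (hM : ∀ i ∈ s, 0 ≤ M i)
    (hSB : ∀ i ∈ s, StripBoundOn (E i) (X i) (M i) r) :
    OffDiagHessBound (∑ i ∈ s, E i) (stripProfile s X M r) := by
  have h := offDiagHessBound_sum s hE
    (fun i hi => offDiagHessBound_of_stripBoundOn (hE i) hr (hM i hi) (hSB i hi))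
  have hfun : (∑ i ∈ s, fun e e' : ι => if e ∈ X i ∧ e' ∈ X i then 2 * (2 * M i / r ^ 2) else (0 : ℝ)) =
      stripProfile s X M r := by
    funext e e'
    rw [Finset.sum_apply, Finset.sum_apply, stripProfile]
    refine Finset.sum_congr rfl fun i _ => ?_
    split_ifs <;> ring
  rwa [hfun] at h

omit [DecidableEq ι] in
/-- A finite sum of `C^∞` ambient functions is `C^∞` (Finset-sum-of-functions form). [folklore] -/
theorem contDiff_finset_sum {K : Type*} (s : Finset K) {E : K → Cfg ι N → ℝ} (hE : ∀ i, ContDiff ℝ ∞ (E i)) :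
    ContDiff ℝ ∞ (∑ i ∈ s, E i) := by
  have h : (∑ i ∈ s, E i) = fun x => ∑ i ∈ s, E i x := funext fun x => Finset.sum_apply _ _ _
  rw [h]
  exact ContDiff.sum fun i _ => hE i

variable {d : ℕ} {L : ℕ} [NeZero L]

/-- ★★★ **THE TYPED BRIDGE, HESSIAN CURRENCY, END TO END (torus, any `d`, `N`, uniform in `L`).**
INPUT = Bałaban's output format at the last RG scale: an effective Wilson coupling `β` and local terms `E i` with strip data
`(X i, M i, r)`; the only non-format hypothesis is `C2PolyApprox (Σ E i)` (D1, C²-Weierstrass).  OUTPUT = exponential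
clustering of `gibbsCov` with rate `κ` and an `L`-independent prefactor, under the door inequality `hK`. [folklore assembly of
the tree's Bakry–Émery chain + §4c–§5b] [folklore] -/
theorem beDoorQL_gibbsCov_le_of_strip {Λ₀ : ℝ} (hH : WilsonHessianBound d N Λ₀) (hN : N ≠ 0) (β : ℝ) (hL : 1 < L)
    {K : Type*} (s : Finset K) {E : K → Cfg (Edge d L) N → ℝ} (hE : ∀ i, ContDiff ℝ ∞ (E i))
    {X : K → Finset (Edge d L)} {M : K → ℝ} {r : ℝ} (hr : 0 < r) (hM : ∀ i ∈ s, 0 ≤ M i)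
    (hSB : ∀ i ∈ s, StripBoundOn (E i) (X i) (M i) r) (hRA : C2PolyApprox (∑ i ∈ s, E i))
    {η : ℝ} (hη : ∀ e, hessLoad s X (fun i => 2 * M i / r ^ 2) e ≤ η)
    (D : Edge d L → ℕ) (hD : ∀ e e', e' ∈ linkNbrT e → D e ≤ D e' + 1) {κ Θ : ℝ} (hκ : 0 ≤ κ)
    (hΘ : ∀ e, ∑ e', stripProfile s X M r e e' * (Real.exp (κ * |(D e : ℝ) - D e'|) - 1) ≤ Θ)
    (hK : 0 < (N : ℝ) / 2 - ((N : ℝ) * |β| * Λ₀ + η) -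
      (max (6 * ((d : ℝ) - 1) * N * |β|) 0 * (Real.exp κ - 1) + Θ))
    {u v : Cfg (Edge d L) N → ℝ} (hu : ContDiff ℝ ∞ u) (hv : ContDiff ℝ ∞ v)
    {δu δv : Edge d L → ℝ} (hδu : ∀ e, 0 ≤ δu e) (hδv : ∀ e, 0 ≤ δv e)
    (hLu : LinkLipschitz u δu) (hLv : LinkLipschitz v δv)
    (hDv : ∀ e, δv e ≠ 0 → D e = 0) {m : ℕ} (hDu : ∀ e, δu e ≠ 0 → m ≤ D e) :
    |gibbsCov (wilsonPot d N L β + ∑ i ∈ s, E i) u v| ≤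
      Real.exp (-κ * m) * (∑ e, δu e) * (∑ e, δv e) /
        ((N : ℝ) / 2 - ((N : ℝ) * |β| * Λ₀ + η) - (max (6 * ((d : ℝ) - 1) * N * |β|) 0 * (Real.exp κ - 1) + Θ)) :=
  beDoorQL_gibbsCov_le_of_approx hH hN β hL (contDiff_finset_sum s hE) hRA (hessBound_sum_of_strip s hE hr hSB hη)
    (offDiagHessBound_sum_of_strip s hE hr hM hSB) (stripProfile_nonneg hM) (stripProfile_symm s X M r) D hD hκ hΘ hK
    hu hv hδu hδv hLu hLv hDv hDu

/-- **(E2′) TYPED: the profile constant from format data.**  If every localisation domain `X i` has `D`-oscillation at most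
`δ i` (`|D e − D e'| ≤ δ i` on `X i` — e.g. `δ i = |X i|` for Wilson-connected domains and `D` 1-Lipschitz along Wilson neighbours),
then the `κ`-weighted row sums of the strip profile are bounded by the WEIGHTED LOAD `Σ_{i : e ∈ X i} (4M_i/r²)·|X i|·(e^{κδ_i} − 1)`.
[folklore] -/
theorem stripProfile_row_le {K : Type*} (s : Finset K) {X : K → Finset ι} {M : K → ℝ} {r : ℝ} (hM : ∀ i ∈ s, 0 ≤ M i)
    (D : ι → ℕ) {κ : ℝ} (hκ : 0 ≤ κ) {δ : K → ℝ}
    (hδ : ∀ i ∈ s, ∀ e ∈ X i, ∀ e' ∈ X i, |(D e : ℝ) - D e'| ≤ δ i) (e : ι) :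
    ∑ e', stripProfile s X M r e e' * (Real.exp (κ * |(D e : ℝ) - D e'|) - 1) ≤
      ∑ i ∈ s, if e ∈ X i then 4 * M i / r ^ 2 * (X i).card * (Real.exp (κ * δ i) - 1) else 0 := by
  classical
  simp only [stripProfile, Finset.sum_mul]
  rw [Finset.sum_comm]
  refine Finset.sum_le_sum fun i hi => ?_
  have hc : 0 ≤ 4 * M i / r ^ 2 := div_nonneg (mul_nonneg (by norm_num) (hM i hi)) (sq_nonneg r)
  by_cases he : e ∈ X i
  · rw [if_pos he]
    have h1 : ∀ e', (if e ∈ X i ∧ e' ∈ X i then 4 * M i / r ^ 2 else 0) * (Real.exp (κ * |(D e : ℝ) - D e'|) - 1) =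
        if e' ∈ X i then 4 * M i / r ^ 2 * (Real.exp (κ * |(D e : ℝ) - D e'|) - 1) else 0 := by
      intro e'
      by_cases he' : e' ∈ X i
      · rw [if_pos ⟨he, he'⟩, if_pos he']
      · rw [if_neg (fun h => he' h.2), if_neg he', zero_mul]
    simp_rw [h1]
    rw [Finset.sum_ite_mem, Finset.univ_inter]
    calc ∑ e' ∈ X i, 4 * M i / r ^ 2 * (Real.exp (κ * |(D e : ℝ) - D e'|) - 1)
        ≤ ∑ _e' ∈ X i, 4 * M i / r ^ 2 * (Real.exp (κ * δ i) - 1) :=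
          Finset.sum_le_sum fun e' he' => mul_le_mul_of_nonneg_left
            (sub_le_sub_right (Real.exp_le_exp.2 (mul_le_mul_of_nonneg_left (hδ i hi e he e' he') hκ)) 1) hc
      _ = 4 * M i / r ^ 2 * (X i).card * (Real.exp (κ * δ i) - 1) := by
          rw [Finset.sum_const, nsmul_eq_mul]; ring
  · rw [if_neg he]
    refine le_of_eq (Finset.sum_eq_zero fun e' _ => ?_)
    rw [if_neg (fun h => he h.1), zero_mul]

/-- ★★★ **THE TYPED BRIDGE FROM FORMAT DATA ALONE** (`X i, M i, r, δ i` + the two loads `η`, `Θ`): as `beDoorQL_gibbsCov_le_of_strip` with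
the profile hypothesis discharged by `stripProfile_row_le`. [folklore assembly] [folklore] -/
theorem beDoorQL_gibbsCov_le_of_format {Λ₀ : ℝ} (hH : WilsonHessianBound d N Λ₀) (hN : N ≠ 0) (β : ℝ) (hL : 1 < L)
    {K : Type*} (s : Finset K) {E : K → Cfg (Edge d L) N → ℝ} (hE : ∀ i, ContDiff ℝ ∞ (E i))
    {X : K → Finset (Edge d L)} {M : K → ℝ} {r : ℝ} (hr : 0 < r) (hM : ∀ i ∈ s, 0 ≤ M i)
    (hSB : ∀ i ∈ s, StripBoundOn (E i) (X i) (M i) r) (hRA : C2PolyApprox (∑ i ∈ s, E i))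
    {η : ℝ} (hη : ∀ e, hessLoad s X (fun i => 2 * M i / r ^ 2) e ≤ η)
    (D : Edge d L → ℕ) (hD : ∀ e e', e' ∈ linkNbrT e → D e ≤ D e' + 1) {κ Θ : ℝ} (hκ : 0 ≤ κ) {δ : K → ℝ}
    (hδ : ∀ i ∈ s, ∀ e ∈ X i, ∀ e' ∈ X i, |(D e : ℝ) - D e'| ≤ δ i)
    (hΘ : ∀ e, ∑ i ∈ s, (if e ∈ X i then 4 * M i / r ^ 2 * (X i).card * (Real.exp (κ * δ i) - 1) else 0) ≤ Θ)
    (hK : 0 < (N : ℝ) / 2 - ((N : ℝ) * |β| * Λ₀ + η) -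
      (max (6 * ((d : ℝ) - 1) * N * |β|) 0 * (Real.exp κ - 1) + Θ))
    {u v : Cfg (Edge d L) N → ℝ} (hu : ContDiff ℝ ∞ u) (hv : ContDiff ℝ ∞ v)
    {δu δv : Edge d L → ℝ} (hδu : ∀ e, 0 ≤ δu e) (hδv : ∀ e, 0 ≤ δv e)
    (hLu : LinkLipschitz u δu) (hLv : LinkLipschitz v δv)
    (hDv : ∀ e, δv e ≠ 0 → D e = 0) {m : ℕ} (hDu : ∀ e, δu e ≠ 0 → m ≤ D e) :
    |gibbsCov (wilsonPot d N L β + ∑ i ∈ s, E i) u v| ≤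
      Real.exp (-κ * m) * (∑ e, δu e) * (∑ e, δv e) /
        ((N : ℝ) / 2 - ((N : ℝ) * |β| * Λ₀ + η) - (max (6 * ((d : ℝ) - 1) * N * |β|) 0 * (Real.exp κ - 1) + Θ)) :=
  beDoorQL_gibbsCov_le_of_strip hH hN β hL s hE hr hM hSB hRA hη D hD hκ
    (fun e => (stripProfile_row_le s hM D hκ hδ e).trans (hΘ e)) hK hu hv hδu hδv hLu hLv hDv hDu

end StripDoor

/-! ## §6 MEASURE GLUE (v5): the door's output in the cell's measure object `W.perturbedMeasure`

Seat P2's bridge `yangMills_of_legs` and the tree's robust ball (`RobustBall.ClustersWith`, `LangevinPoincareBall`) speak about the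
MEMBER MEASURES `μ_{β,W,L} = Z⁻¹ e^{−β_tree S_W − W} ∏ dU_e` = `QuasiLocalGaugePerturbation.perturbedMeasure` (block scale `b`;
`RobustBall.Perturbation` is `b = 1`) and observables `U ↦ f (emb U)`.  The door speaks about `gibbsCov (wilsonPot β + R) u v`, `R` an
ambient potential on `(E → M_N(ℂ))`.  The two are the SAME NUMBER as soon as `R ∘ emb = −W.total` (tree coupling `Nβ`, normalised
coupling `β`): the Wilson weight at tree coupling `Nβ` is a constant times `e^{wilsonPot β}` (`exp_neg_mul_wilsonAction_eq`), the member
measure is the Haar tilt by the full action (`QuasiLocalGaugePerturbation.perturbedMeasure_eq_tilted`), the constants cancel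
(`integral_perturbedMeasure_eq_div`, `covariance_perturbedMeasure_eq`).  Hence the end-to-end format theorem and the polynomial door
read DIRECTLY on the member measure: `perturbedMeasure_cov_le_of_format`, `perturbedMeasure_cov_le_of_poly` — the statement shape of
`RobustBall.ClustersWith` restricted to smooth ambient observables (general bounded Lipschitz observables of `ClustersWith` would need
a Lipschitz → smooth approximation on `SU(N)^E`, not done here). -/

section MeasureGlue

variable {d N : ℕ} {L : ℕ} [NeZero L]

open scoped ProbabilityTheory
open ProbabilityTheory
open Literature.MathematicalPhysics.QuantumLattice (fundamentalRep continuous_fundamentalRep)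

/-- **Member-measure expectations as `e^{wilsonPot β + R}`-weighted Haar averages**: for every block scale `b`, every member `W`,
every ambient `R` with `R ∘ emb = −W.total` and every `φ`,
`∫ φ dμ_{Nβ,W,L} = (∫ e^{(wilsonPot β + R)∘emb} φ dσ^{⊗E}) / ∫ e^{(wilsonPot β + R)∘emb} dσ^{⊗E}`. [folklore] -/
theorem integral_perturbedMeasure_eq_div {b : ℕ} (W : QuasiLocalGaugePerturbation d L (SUN N) b) (β : ℝ)
    {R : Cfg (Edge d L) N → ℝ} (hR : ∀ U : PSU (Edge d L) N, R (emb U) = -W.total U) (φ : PSU (Edge d L) N → ℝ) :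
    ∫ U, φ U ∂(W.perturbedMeasure (fundamentalRep (Fin N)) ((N : ℝ) * β)) =
      (∫ U, Real.exp ((wilsonPot d N L β + R) (emb U)) * φ U ∂(haarPi (Edge d L) N)) /
        ∫ U, Real.exp ((wilsonPot d N L β + R) (emb U)) ∂(haarPi (Edge d L) N) := by
  haveI : SecondCountableTopology (Matrix (Fin N) (Fin N) ℂ) :=
    inferInstanceAs (SecondCountableTopology (Fin N → Fin N → ℂ))
  haveI : SecondCountableTopology (SUN N) := Topology.IsEmbedding.subtypeVal.secondCountableTopology
  rw [QuasiLocalGaugePerturbation.perturbedMeasure_eq_tilted (fundamentalRep (Fin N))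
    (continuous_fundamentalRep (n := Fin N)) ((N : ℝ) * β) W, integral_tilted]
  have hCpos : 0 < Real.exp (-((N : ℝ) * β * N * Fintype.card (Plaquette d L))) := Real.exp_pos _
  have hf : ∀ U : PSU (Edge d L) N,
      Real.exp (-((N : ℝ) * β) * wilsonAction (fundamentalRep (Fin N)) U - W.total U) =
        Real.exp (-((N : ℝ) * β * N * Fintype.card (Plaquette d L))) * Real.exp ((wilsonPot d N L β + R) (emb U)) := by
    intro U
    rw [Real.exp_sub, exp_neg_mul_wilsonAction_eq, Pi.add_apply, Real.exp_add, hR U, Real.exp_neg (W.total U)]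
    ring
  simp_rw [hf, integral_const_mul, smul_eq_mul, mul_div_mul_left _ _ hCpos.ne', div_mul_eq_mul_div]
  rw [integral_div]

/-- The member measure is a probability measure, every block scale (tilt of product Haar by a bounded measurable action). [folklore] -/
theorem isProbabilityMeasure_perturbedMeasure {b : ℕ} (W : QuasiLocalGaugePerturbation d L (SUN N) b) (β : ℝ) :
    IsProbabilityMeasure (W.perturbedMeasure (fundamentalRep (Fin N)) β) := by
  haveI : SecondCountableTopology (Matrix (Fin N) (Fin N) ℂ) :=
    inferInstanceAs (SecondCountableTopology (Fin N → Fin N → ℂ))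
  haveI : SecondCountableTopology (SUN N) := Topology.IsEmbedding.subtypeVal.secondCountableTopology
  rw [QuasiLocalGaugePerturbation.perturbedMeasure_eq_tilted (fundamentalRep (Fin N))
    (continuous_fundamentalRep (n := Fin N)) β W]
  exact isProbabilityMeasure_tilted
    (Literature.Probability.LatticeModels.integrable_exp_of_abs_le _
      (QuasiLocalGaugePerturbation.measurable_action (fundamentalRep (Fin N)) (continuous_fundamentalRep (n := Fin N)) β W)
      (QuasiLocalGaugePerturbation.exists_abs_action_le (fundamentalRep (Fin N)) (continuous_fundamentalRep (n := Fin N)) β W))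

/-- **The covariance of smooth ambient observables in the member measure IS the door's Gibbs covariance**:
`Cov_{μ_{Nβ,W,L}}(u∘emb, v∘emb) = gibbsCov (wilsonPot β + R) u v` whenever `R ∘ emb = −W.total`. [folklore] -/
theorem covariance_perturbedMeasure_eq {b : ℕ} (W : QuasiLocalGaugePerturbation d L (SUN N) b) (β : ℝ)
    {R : Cfg (Edge d L) N → ℝ} (hR : ∀ U : PSU (Edge d L) N, R (emb U) = -W.total U)
    {u v : Cfg (Edge d L) N → ℝ} (hu : ContDiff ℝ ∞ u) (hv : ContDiff ℝ ∞ v) :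
    cov[fun U => u (emb U), fun U => v (emb U); W.perturbedMeasure (fundamentalRep (Fin N)) ((N : ℝ) * β)] =
      gibbsCov (wilsonPot d N L β + R) u v := by
  set μ := W.perturbedMeasure (fundamentalRep (Fin N)) ((N : ℝ) * β) with hμ
  haveI := isProbabilityMeasure_perturbedMeasure W ((N : ℝ) * β)
  obtain ⟨Cu, -, hCu⟩ := exists_bound_restrict (ι := Edge d L) hu
  obtain ⟨Cv, -, hCv⟩ := exists_bound_restrict (ι := Edge d L) hv
  have hmu : MemLp (fun U : PSU (Edge d L) N => u (emb U)) 2 μ :=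
    MemLp.of_bound (continuous_restrict hu).aestronglyMeasurable Cu
      (ae_of_all _ fun U => by rw [Real.norm_eq_abs]; exact hCu U)
  have hmv : MemLp (fun U : PSU (Edge d L) N => v (emb U)) 2 μ :=
    MemLp.of_bound (continuous_restrict hv).aestronglyMeasurable Cv
      (ae_of_all _ fun U => by rw [Real.norm_eq_abs]; exact hCv U)
  rw [covariance_eq_sub hmu hmv]
  have e1 : ∫ U, ((fun U : PSU (Edge d L) N => u (emb U)) * fun U => v (emb U)) U ∂μ =
      (∫ U, Real.exp ((wilsonPot d N L β + R) (emb U)) * (u (emb U) * v (emb U)) ∂(haarPi (Edge d L) N)) /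
        ∫ U, Real.exp ((wilsonPot d N L β + R) (emb U)) ∂(haarPi (Edge d L) N) :=
    integral_perturbedMeasure_eq_div W β hR _
  have e2 : ∫ U, u (emb U) ∂μ =
      (∫ U, Real.exp ((wilsonPot d N L β + R) (emb U)) * u (emb U) ∂(haarPi (Edge d L) N)) /
        ∫ U, Real.exp ((wilsonPot d N L β + R) (emb U)) ∂(haarPi (Edge d L) N) :=
    integral_perturbedMeasure_eq_div W β hR _
  have e3 : ∫ U, v (emb U) ∂μ =
      (∫ U, Real.exp ((wilsonPot d N L β + R) (emb U)) * v (emb U) ∂(haarPi (Edge d L) N)) /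
        ∫ U, Real.exp ((wilsonPot d N L β + R) (emb U)) ∂(haarPi (Edge d L) N) :=
    integral_perturbedMeasure_eq_div W β hR _
  rw [e1, e2, e3]
  rfl

/-- **THE POLYNOMIAL DOOR ON THE MEMBER MEASURE**: `beDoor_gibbsCov_le` for the member `W` whose total perturbation is (the
restriction of) a polynomial `R` of finite range inside the Hessian door — one constant for every torus and every pair of smooth
ambient observables. [folklore] -/
theorem perturbedMeasure_cov_le_of_poly {Λ₀ : ℝ} (hH : WilsonHessianBound d N Λ₀) (hN : N ≠ 0) (β : ℝ) (hL : 1 < L)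
    {b : ℕ} (W : QuasiLocalGaugePerturbation d L (SUN N) b)
    {R : Cfg (Edge d L) N → ℝ} (hW : ∀ U : PSU (Edge d L) N, R (emb U) = -W.total U)
    {dR : ℕ} (hRp : R ∈ polySpace (Edge d L) N dR)
    {ΛR : ℝ} (hRH : HessBound R ΛR) {hR : Edge d L → Edge d L → ℝ} (hRO : OffDiagHessBound R hR)
    (hR0 : ∀ e e', 0 ≤ hR e e') (hRsymm : ∀ e e', hR e e' = hR e' e) {HR : ℝ} (hHR0 : 0 ≤ HR)
    (hRrow : ∀ e, ∑ e', hR e e' ≤ HR) (hK : 0 < (N : ℝ) / 2 - ((N : ℝ) * |β| * Λ₀ + ΛR))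
    {u v : Cfg (Edge d L) N → ℝ} (hu : ContDiff ℝ ∞ u) (hv : ContDiff ℝ ∞ v)
    {δu δv : Edge d L → ℝ} (hδu : ∀ e, 0 ≤ δu e) (hδv : ∀ e, 0 ≤ δv e)
    (hLu : LinkLipschitz u δu) (hLv : LinkLipschitz v δv)
    (D : Edge d L → ℕ) (hD : ∀ e e', (e' ∈ linkNbrT e ∨ hR e e' ≠ 0) → D e ≤ D e' + 1)
    (hDv : ∀ e, δv e ≠ 0 → D e = 0) {m : ℕ} (hDu : ∀ e, δu e ≠ 0 → m ≤ D e) :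
    |cov[fun U => u (emb U), fun U => v (emb U); W.perturbedMeasure (fundamentalRep (Fin N)) ((N : ℝ) * β)]| ≤
      2 / ((N : ℝ) / 2 - ((N : ℝ) * |β| * Λ₀ + ΛR)) *
        Real.exp (-(min 1 (((N : ℝ) / 2 - ((N : ℝ) * |β| * Λ₀ + ΛR)) /
          (4 * (max (6 * ((d : ℝ) - 1) * N * |β|) 0 + HR) + 1))) * m) *
        (∑ e, δu e) * (∑ e, δv e) := by
  rw [covariance_perturbedMeasure_eq W β hW hu hv]
  exact beDoor_gibbsCov_le hH hN β hL hRp hRH hRO hR0 hRsymm hHR0 hRrow hK hu hv hδu hδv hLu hLv D hD hDv hDu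

/-- ★★★ **THE FORMAT THEOREM ON THE MEMBER MEASURE** (end-to-end, v5): for every block scale `b` and every member `W` whose total
perturbation is (minus the restriction to `SU(N)^E` of) a finite sum of smooth ambient activities `E_i` in Bałaban's analyticity FORMAT —
`E_i` bounded by `M_i` on the complex strip of width `r` around `SU(N)^E` in the directions supported on `X_i` (`StripBoundOn`), the sum
C²-approximable by polynomials (`C2PolyApprox`, D1) — with per-link Hessian load `sup_e ∑_{i ∋ e} 2M_i/r² ≤ η`, quasi-local weight
`∑_{i ∋ e} 4M_i|X_i|(e^{κδ_i} − 1)/r² ≤ Θ` (`δ_i` the `D`-oscillation on `X_i`) and the DOOR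
`K := N/2 − (N|β|Λ₀ + η) − (H_W(e^κ − 1) + Θ) > 0`: for every torus side `L ≥ 2` and every pair of smooth link-Lipschitz ambient
observables `m` apart in `D`, `|Cov_{μ_{Nβ,W,L}}(u∘emb, v∘emb)| ≤ K⁻¹ e^{−κ m} (Σδu)(Σδv)` — the member's OWN measure, one constant for
every volume.  (= `covariance_perturbedMeasure_eq` ∘ `beDoorQL_gibbsCov_le_of_format`.) [folklore] -/
theorem perturbedMeasure_cov_le_of_format {Λ₀ : ℝ} (hH : WilsonHessianBound d N Λ₀) (hN : N ≠ 0) (β : ℝ) (hL : 1 < L)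
    {b : ℕ} (W : QuasiLocalGaugePerturbation d L (SUN N) b)
    {K : Type*} (s : Finset K) {E : K → Cfg (Edge d L) N → ℝ} (hE : ∀ i, ContDiff ℝ ∞ (E i))
    (hW : ∀ U : PSU (Edge d L) N, (∑ i ∈ s, E i) (emb U) = -W.total U)
    {X : K → Finset (Edge d L)} {M : K → ℝ} {r : ℝ} (hr : 0 < r) (hM : ∀ i ∈ s, 0 ≤ M i)
    (hSB : ∀ i ∈ s, StripBoundOn (E i) (X i) (M i) r) (hRA : C2PolyApprox (∑ i ∈ s, E i))
    {η : ℝ} (hη : ∀ e, hessLoad s X (fun i => 2 * M i / r ^ 2) e ≤ η)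
    (D : Edge d L → ℕ) (hD : ∀ e e', e' ∈ linkNbrT e → D e ≤ D e' + 1) {κ Θ : ℝ} (hκ : 0 ≤ κ) {δ : K → ℝ}
    (hδ : ∀ i ∈ s, ∀ e ∈ X i, ∀ e' ∈ X i, |(D e : ℝ) - D e'| ≤ δ i)
    (hΘ : ∀ e, ∑ i ∈ s, (if e ∈ X i then 4 * M i / r ^ 2 * (X i).card * (Real.exp (κ * δ i) - 1) else 0) ≤ Θ)
    (hK : 0 < (N : ℝ) / 2 - ((N : ℝ) * |β| * Λ₀ + η) -
      (max (6 * ((d : ℝ) - 1) * N * |β|) 0 * (Real.exp κ - 1) + Θ))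
    {u v : Cfg (Edge d L) N → ℝ} (hu : ContDiff ℝ ∞ u) (hv : ContDiff ℝ ∞ v)
    {δu δv : Edge d L → ℝ} (hδu : ∀ e, 0 ≤ δu e) (hδv : ∀ e, 0 ≤ δv e)
    (hLu : LinkLipschitz u δu) (hLv : LinkLipschitz v δv)
    (hDv : ∀ e, δv e ≠ 0 → D e = 0) {m : ℕ} (hDu : ∀ e, δu e ≠ 0 → m ≤ D e) :
    |cov[fun U => u (emb U), fun U => v (emb U); W.perturbedMeasure (fundamentalRep (Fin N)) ((N : ℝ) * β)]| ≤
      Real.exp (-κ * m) * (∑ e, δu e) * (∑ e, δv e) /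
        ((N : ℝ) / 2 - ((N : ℝ) * |β| * Λ₀ + η) - (max (6 * ((d : ℝ) - 1) * N * |β|) 0 * (Real.exp κ - 1) + Θ)) := by
  rw [covariance_perturbedMeasure_eq W β hW hu hv]
  exact beDoorQL_gibbsCov_le_of_format hH hN β hL s hE hr hM hSB hRA hη D hD hκ hδ hΘ hK hu hv hδu hδv hLu hLv hDv hDu

end MeasureGlue

end Summit.Ventures.YMGap.BEDoor
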